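import Mathlib
import Summits.Ventures.PercRepro2.HCovCubic
import Summits.Ventures.PercRepro2.ConnReach

/-!
# `K₃` through ten connection bits (blind cell PercRepro2, typer-1 g45, 2026-08-27)

The eight-term kernel `K₃` (`HCovCubic.lean`) reads a configuration only through the indicator
functions `iPD, iQ, iL, iH` of `HCovFns.lean`, i.e. through ten connection facts of the marks
`o, a₁, a₂, a₃, b`.  With the edges as ordered pairs (`ConnReach.lean`):

* `Bits` — the ten facts as Booleans, `bitsOf pairs ω o a₁ a₂ a₃ b` their computable values
  (three `reachSet`s);
* `K3s : Bits → Bits → Bits → ℚ` — the kernel on bits;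
* `K3_eq_K3s : K3 ends o a₁ a₂ a₃ b x y w = K3s (bitsOf …x…) (bitsOf …y…) (bitsOf …w…)`.

Written for the kernel refutation of (TRI-o) (`TypedBasesStarRefutation.lean`).  Own work;
standard axioms.
-/

namespace Summit.Ventures.PercRepro2

namespace CovForm

/-- The ten connection bits `K₃` reads: `hl = [a₁ ∈ C(a₂)]`, `lh = [a₂ ∈ C(a₁)]`,
`tl = [a₁ ∈ C(a₃)]`, `th = [a₂ ∈ C(a₃)]`, `lo / ho = [o ∈ C(a₁) / C(a₂)]`,
`lb / hb = [b ∈ C(a₁) / C(a₂)]`, `lt / ht = [a₃ ∈ C(a₁) / C(a₂)]`. -/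
structure Bits where
  /-- `a₁ ∈ C(a₂)` -/
  hl : Bool
  /-- `a₂ ∈ C(a₁)` -/
  lh : Bool
  /-- `a₁ ∈ C(a₃)` -/
  tl : Bool
  /-- `a₂ ∈ C(a₃)` -/
  th : Bool
  /-- `o ∈ C(a₁)` -/
  lo : Bool
  /-- `o ∈ C(a₂)` -/
  ho : Bool
  /-- `b ∈ C(a₁)` -/
  lb : Bool
  /-- `b ∈ C(a₂)` -/
  hb : Bool
  /-- `a₃ ∈ C(a₁)` -/
  lt : Bool
  /-- `a₃ ∈ C(a₂)` -/
  ht : Bool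
  deriving DecidableEq

section BitsDef

variable {V : Type*} {E : Type*} [Fintype V] [DecidableEq V] [Fintype E]

/-- The bits read off three clusters `R1 = C(a₁)`, `R2 = C(a₂)`, `R3 = C(a₃)`. -/
def bitsOfSets (R1 R2 R3 : Finset V) (o a₁ a₂ a₃ b : V) : Bits :=
  ⟨decide (a₁ ∈ R2), decide (a₂ ∈ R1), decide (a₁ ∈ R3), decide (a₂ ∈ R3), decide (o ∈ R1),
    decide (o ∈ R2), decide (b ∈ R1), decide (b ∈ R2), decide (a₃ ∈ R1), decide (a₃ ∈ R2)⟩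

/-- The computable bits of a configuration. -/
def bitsOf (pairs : E → V × V) (ω : Config E) (o a₁ a₂ a₃ b : V) : Bits :=
  bitsOfSets (reachSet pairs ω a₁) (reachSet pairs ω a₂) (reachSet pairs ω a₃) o a₁ a₂ a₃ b

end BitsDef

/-! ## The twelve functions on bits -/

/-- `[x]` as a rational. -/
def bq (x : Bool) : ℚ := if x then 1 else 0

/-- `1_Q = [a₁ ∉ C(a₂)]`. -/
def iQs (s : Bits) : ℚ := if s.hl then 0 else 1

/-- `1_PD = [a₂ ∉ C(a₁)] [a₁ ∉ C(a₃)] [a₂ ∉ C(a₃)]`. -/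
def iPDs (s : Bits) : ℚ := if s.lh || s.tl || s.th then 0 else 1

/-- `σ_o`. -/
def sigOs (s : Bits) : ℚ := bq s.lo - bq s.ho

/-- `1_{o ∈ U}`. -/
def inUOs (s : Bits) : ℚ := bq s.lo + bq s.ho

/-- `σ_b`. -/
def sigBs (s : Bits) : ℚ := bq s.lb - bq s.hb

/-- `1_{b ∈ U}`. -/
def inUBs (s : Bits) : ℚ := bq s.lb + bq s.hb

/-- `σ₃`. -/
def sigTs (s : Bits) : ℚ := bq s.lt - bq s.ht

/-- `f₃ = 1_PD 1_{o∈U}`. -/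
def f3s (s : Bits) : ℚ := iPDs s * inUOs s

/-- `f₄ = 1_Q σ_o σ_b`. -/
def f4s (s : Bits) : ℚ := iQs s * (sigOs s * sigBs s)

/-- `f₅ = 1_Q σ₃ σ_b`. -/
def f5s (s : Bits) : ℚ := iQs s * (sigTs s * sigBs s)

/-- `f₆ = 1_Q σ₃ 1_{o∈U} σ_b`. -/
def f6s (s : Bits) : ℚ := iQs s * (sigTs s * (inUOs s * sigBs s))

/-- `f₇(b) = 1_Q σ_b`. -/
def f7bs (s : Bits) : ℚ := iQs s * sigBs s

/-- `f₇(o) = 1_Q σ_o`. -/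
def f7os (s : Bits) : ℚ := iQs s * sigOs s

/-- `f₇(a₃) = 1_Q σ₃`. -/
def f7ts (s : Bits) : ℚ := iQs s * sigTs s

/-- `f₁₀ = 1_Q σ₃ 1_{o∈U}`. -/
def f10s (s : Bits) : ℚ := iQs s * (sigTs s * inUOs s)

/-- `f₁₁ = 1_PD 1_{o∈U} 1_{b∈U}`. -/
def f11s (s : Bits) : ℚ := iPDs s * (inUOs s * inUBs s)

/-- `f₁₂ = 1_PD 1_{b∈U}`. -/
def f12s (s : Bits) : ℚ := iPDs s * inUBs s

/-- **`K₃` on bits**: p1's eight terms (`HCovCubic.K3`) evaluated through the bits. -/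
def K3s (x y w : Bits) : ℚ :=
  iPDs x * (iQs y * f4s w) + iQs x * (f3s y * f5s w) - iPDs x * (iQs y * f6s w)
    - iPDs x * (f7bs y * f7os w) - f3s x * (f7bs y * f7ts w) + iPDs x * (f7bs y * f10s w)
    - iPDs x * (iQs y * f11s w) + iQs x * (f12s y * f3s w)

/-! ## The bridge -/

section Bridge

variable {V : Type*} {E : Type*} [Fintype V] [DecidableEq V] [Fintype E] [DecidableEq E]
  {ends : E → Sym2 V} {pairs : E → V × V}

omit [Fintype V] [DecidableEq V] [Fintype E] [DecidableEq E] in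
/-- Membership in `Q = {a₂ ↮ a₁}`. -/
lemma mem_avoidAll_singleton (ω : Config E) (a₁ a₂ : V) :
    ω ∈ avoidAll ends a₂ {a₁} ↔ ¬ Conn ends ω a₂ a₁ := by
  simp only [avoidAll, Set.mem_setOf_eq, Finset.mem_singleton, forall_eq]

omit [Fintype V] [DecidableEq V] [Fintype E] [DecidableEq E] in
/-- Membership in `PD = {a₁ ↮ a₂, a₃ ∉ C(a₁) ∪ C(a₂)}`. -/
lemma mem_PDEvent_iff (ω : Config E) (a₁ a₂ a₃ : V) :
    ω ∈ PDEvent ends a₁ a₂ a₃ ↔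
      ¬ Conn ends ω a₁ a₂ ∧ ¬ (Conn ends ω a₃ a₁ ∨ Conn ends ω a₃ a₂) := by
  simp only [PDEvent, Dtilde, UnionCluster.inU, connEvent, Set.mem_inter_iff, Set.mem_compl_iff,
    Set.mem_union, Set.mem_setOf_eq]

omit [DecidableEq E] in
/-- `1_{v ∈ C₁}` through the bits. -/
lemma iL_eq (hp : ∀ e, ends e = s((pairs e).1, (pairs e).2)) (a₁ v : V) (ω : Config E) :
    iL ends a₁ v ω = bq (decide (v ∈ reachSet pairs ω a₁)) := by
  unfold iL bq
  by_cases h : Conn ends ω a₁ v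
  · have h' : v ∈ reachSet pairs ω a₁ := (conn_iff_mem_reachSet hp).1 h
    rw [Set.indicator_of_mem (show ω ∈ connEvent ends a₁ v from h)]
    simp [h']
  · have h' : v ∉ reachSet pairs ω a₁ := fun h' => h ((conn_iff_mem_reachSet hp).2 h')
    rw [Set.indicator_of_notMem (show ω ∉ connEvent ends a₁ v from h)]
    simp [h']

omit [DecidableEq E] in
/-- `1_{v ∈ C₂}` through the bits. -/
lemma iH_eq (hp : ∀ e, ends e = s((pairs e).1, (pairs e).2)) (a₂ v : V) (ω : Config E) :
    iH ends a₂ v ω = bq (decide (v ∈ reachSet pairs ω a₂)) := by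
  unfold iH bq
  by_cases h : Conn ends ω a₂ v
  · have h' : v ∈ reachSet pairs ω a₂ := (conn_iff_mem_reachSet hp).1 h
    rw [Set.indicator_of_mem (show ω ∈ connEvent ends a₂ v from h)]
    simp [h']
  · have h' : v ∉ reachSet pairs ω a₂ := fun h' => h ((conn_iff_mem_reachSet hp).2 h')
    rw [Set.indicator_of_notMem (show ω ∉ connEvent ends a₂ v from h)]
    simp [h']

omit [DecidableEq E] in
/-- `1_Q` through the bits. -/
lemma iQ_eq (hp : ∀ e, ends e = s((pairs e).1, (pairs e).2)) (o a₁ a₂ a₃ b : V)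
    (ω : Config E) : iQ ends a₁ a₂ ω = iQs (bitsOf pairs ω o a₁ a₂ a₃ b) := by
  unfold iQ iQs bitsOf bitsOfSets
  by_cases h : Conn ends ω a₂ a₁
  · have h' : a₁ ∈ reachSet pairs ω a₂ := (conn_iff_mem_reachSet hp).1 h
    rw [Set.indicator_of_notMem (by rw [mem_avoidAll_singleton]; exact not_not.2 h)]
    simp [h']
  · have h' : a₁ ∉ reachSet pairs ω a₂ := fun h' => h ((conn_iff_mem_reachSet hp).2 h')
    rw [Set.indicator_of_mem (by rw [mem_avoidAll_singleton]; exact h)]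
    simp [h']

omit [DecidableEq E] in
/-- `1_PD` through the bits. -/
lemma iPD_eq (hp : ∀ e, ends e = s((pairs e).1, (pairs e).2)) (o a₁ a₂ a₃ b : V)
    (ω : Config E) : iPD ends a₁ a₂ a₃ ω = iPDs (bitsOf pairs ω o a₁ a₂ a₃ b) := by
  unfold iPD iPDs bitsOf bitsOfSets
  by_cases h : ω ∈ PDEvent ends a₁ a₂ a₃
  · rw [Set.indicator_of_mem h]
    rw [mem_PDEvent_iff, not_or] at h
    obtain ⟨h1, h2, h3⟩ := h
    have h1' : a₂ ∉ reachSet pairs ω a₁ := fun h' => h1 ((conn_iff_mem_reachSet hp).2 h')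
    have h2' : a₁ ∉ reachSet pairs ω a₃ := fun h' => h2 ((conn_iff_mem_reachSet hp).2 h')
    have h3' : a₂ ∉ reachSet pairs ω a₃ := fun h' => h3 ((conn_iff_mem_reachSet hp).2 h')
    simp [h1', h2', h3']
  · rw [Set.indicator_of_notMem h]
    rw [mem_PDEvent_iff, not_and_or, not_not, not_or, not_and_or, not_not, not_not] at h
    rcases h with h | h | h
    · have h' : a₂ ∈ reachSet pairs ω a₁ := (conn_iff_mem_reachSet hp).1 h
      simp [h']
    · have h' : a₁ ∈ reachSet pairs ω a₃ := (conn_iff_mem_reachSet hp).1 h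
      simp [h']
    · have h' : a₂ ∈ reachSet pairs ω a₃ := (conn_iff_mem_reachSet hp).1 h
      simp [h']

omit [DecidableEq E] in
/-- `σ_o` through the bits. -/
lemma sigma_o_eq (hp : ∀ e, ends e = s((pairs e).1, (pairs e).2)) (o a₁ a₂ a₃ b : V)
    (ω : Config E) : sigma ends a₁ a₂ o ω = sigOs (bitsOf pairs ω o a₁ a₂ a₃ b) := by
  unfold sigma sigOs bitsOf bitsOfSets
  rw [iL_eq hp, iH_eq hp]

omit [DecidableEq E] in
/-- `1_{o ∈ U}` through the bits. -/
lemma inU_o_eq (hp : ∀ e, ends e = s((pairs e).1, (pairs e).2)) (o a₁ a₂ a₃ b : V)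
    (ω : Config E) : inU ends a₁ a₂ o ω = inUOs (bitsOf pairs ω o a₁ a₂ a₃ b) := by
  unfold inU inUOs bitsOf bitsOfSets
  rw [iL_eq hp, iH_eq hp]

omit [DecidableEq E] in
/-- `σ_b` through the bits. -/
lemma sigma_b_eq (hp : ∀ e, ends e = s((pairs e).1, (pairs e).2)) (o a₁ a₂ a₃ b : V)
    (ω : Config E) : sigma ends a₁ a₂ b ω = sigBs (bitsOf pairs ω o a₁ a₂ a₃ b) := by
  unfold sigma sigBs bitsOf bitsOfSets
  rw [iL_eq hp, iH_eq hp]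

omit [DecidableEq E] in
/-- `1_{b ∈ U}` through the bits. -/
lemma inU_b_eq (hp : ∀ e, ends e = s((pairs e).1, (pairs e).2)) (o a₁ a₂ a₃ b : V)
    (ω : Config E) : inU ends a₁ a₂ b ω = inUBs (bitsOf pairs ω o a₁ a₂ a₃ b) := by
  unfold inU inUBs bitsOf bitsOfSets
  rw [iL_eq hp, iH_eq hp]

omit [DecidableEq E] in
/-- `σ₃` through the bits. -/
lemma sigma_t_eq (hp : ∀ e, ends e = s((pairs e).1, (pairs e).2)) (o a₁ a₂ a₃ b : V)
    (ω : Config E) : sigma ends a₁ a₂ a₃ ω = sigTs (bitsOf pairs ω o a₁ a₂ a₃ b) := by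
  unfold sigma sigTs bitsOf bitsOfSets
  rw [iL_eq hp, iH_eq hp]

omit [DecidableEq E] in
/-- **`K₃` through the bits.** -/
theorem K3_eq_K3s (hp : ∀ e, ends e = s((pairs e).1, (pairs e).2)) (o a₁ a₂ a₃ b : V)
    (x y w : Config E) :
    K3 ends o a₁ a₂ a₃ b x y w =
      K3s (bitsOf pairs x o a₁ a₂ a₃ b) (bitsOf pairs y o a₁ a₂ a₃ b)
        (bitsOf pairs w o a₁ a₂ a₃ b) := by
  unfold K3 sepKernel
  simp only [Fin.sum_univ_succ, Fin.sum_univ_zero, Matrix.cons_val_zero, Matrix.cons_val_succ,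
    add_zero]
  unfold f3 f4 f5 f6 f7 f10 f11 f12
  simp only [iPD_eq hp o a₁ a₂ a₃ b, iQ_eq hp o a₁ a₂ a₃ b, sigma_o_eq hp o a₁ a₂ a₃ b,
    sigma_b_eq hp o a₁ a₂ a₃ b, sigma_t_eq hp o a₁ a₂ a₃ b, inU_o_eq hp o a₁ a₂ a₃ b,
    inU_b_eq hp o a₁ a₂ a₃ b]
  unfold K3s f3s f4s f5s f6s f7bs f7os f7ts f10s f11s f12s
  ring

end Bridge

end CovForm

end Summit.Ventures.PercRepro2
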